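import Summits.ResolutionOfSingularities.ResolutionOfSingularities.Theorems.PurelyInseparableDim4ResConeLightTrichotomy
import Summits.ResolutionOfSingularities.ResolutionOfSingularities.Theorems.PurelyInseparableDim4BandLayers
import HarnessLib
import HarnessLib.Audit.Tags

/-!
# Purely inseparable four-folds — LIGHT-TAIL WEIGHTS at `p = 5`: a heavy newest letter is fatal, `o ≡ 6`,
# and the weight normalisation (cell `res-dim4-pi`, K2(p) lane, slice B brick K26a)

[OURS · counted 0 · cell `res-dim4-pi` · K2(p) lane holder res-dim4-p-12 g3's brick by signature (bus
2026-08-29 01:16Z/01:19Z); LEMMA H and the hand steps res-dim4-idea-4 g3 (01:18Z) / res-dim4-p-12 g3; seat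
res-dim4-p-9 g3.]  Nothing here proves K2(p)/K2(5), `NoIsolatedTrap p p` or resolution of singularities in
dimension ≥ 4 / characteristic `p`; this is the `p = 5`, `d = 3` weight bookkeeping that discharges the
«three alive letters» hypothesis `hB3` of `…ResConeLightTrichotomy` — pure `(r, j, b)` numerics plus ONE
ledgered input taken as a hypothesis: the LIGHT bound `o_k + o_{k+1} + 3 ≤ 3p` at every satellite step
(K12b `satellite_orders_add_three_le_of_ledgers`, which the assembly supplies from its stretch-born ledgers).

With `o_k = |r_k| + 3` (shade 3), `p = 5`: the new letter has weight `|r_k| − 2`, the floor is `|r_k| ≥ 3`,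
the light bound reads `|r_k| + |r_{k+1}| ≤ 6` at satellites, and the upper band `o ≥ 7 = (3p)/2` for ever is
empty (`BandLayers.no_isolated_chain_eventually_upper`).
* §1 CORE over `r : ℕ → Fin 4 →₀ ℕ`: `degree_succ_le_of_hit` (a step hitting a letter of weight `h` has
  `|r_{k+1}| ≤ 2|r_k| − 2 − h`), **`four_le_degree_succ`** (LEMMA H: `|r_k| ≥ 4 ⇒ |r_{k+1}| ≥ 4` — the heavy
  newest letter must be hit, and then the floor breaks), **`light_weights_core`**: if `|r_k| ≤ 3` recurs
  (no upper run) then either a FREE TAIL or, from `k₀` on, `|r_k| = 3` with all weights `≤ 1` (a pre-stretch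
  weight-2 letter is kept for ever and every step hits the newest letter).
* §2 DRESS **`light_weights`**: for a witnessed isolated above-floor `Step0 5` chain of constant shade `3` from
  `k₀`, given the light bound at satellites, (T1) `¬ IsSatellite` eventually ∨ `hwt` (`∀ k ≥ k₀`, weights `≤ 1`,
  `|r_k| = 3`) — hence `hB3` for `light_tail_trichotomy` (`light_tail_trichotomy_five`).

bears_on: LADDER-RESOLUTION:D157-DOOR2 (res-dim4-pi · K2(p) · slice B · K26a).  Supports
stmt-ResolutionOfSingularities-16155 (helper).
-/

set_option linter.dupNamespace false -- mandated namespace of this single-conjunct summit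

noncomputable section

namespace Summit.ResolutionOfSingularities.ResolutionOfSingularities.Theorems.PIDim4

namespace ResCone

open MvPolynomial Finset
open Literature.AlgebraicGeometry.Resolution
open Literature.AlgebraicGeometry.Resolution.CentreBlowup
open Literature.AlgebraicGeometry.Resolution.Hauser2010
open Literature.AlgebraicGeometry.Resolution.HauserPerlega2019

variable {K : Type} [Field K]

/-! ## 1. The core numerics of the `p = 5` light tail -/

section Core

variable [DecidableEq K]

/-- Values of the boundary law: the new letter gets `|r_k| − 2`, a kept letter keeps its weight, a translated one
is lost. [folklore] -/
theorem law_apply {r : ℕ → Fin 4 →₀ ℕ} {j : ℕ → Fin 4} {b : ℕ → Fin 4 → K} {k : ℕ}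
    (hlaw : r (k + 1) = ((r k).filter (fun i => b k i = 0)).update (j k) ((r k).degree - 2)) (i : Fin 4) :
    r (k + 1) i = if i = j k then (r k).degree - 2 else if b k i = 0 then r k i else 0 := by
  rw [hlaw, Finsupp.coe_update]
  by_cases hij : i = j k
  · rw [if_pos hij, hij, Function.update_self]
  · rw [if_neg hij, Function.update_of_ne hij, Finsupp.filter_apply]

/-- The degree after a step: `|r_{k+1}| = (|r_k| − 2) + Σ_{i ≠ j k, b k i = 0} r_k i`, as the bound
`|r_{k+1}| + r_k N ≤ (|r_k| − 2) + |r_k|` for any letter `N` HIT by the step (`N = j k` or `b k N ≠ 0`), using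
`b k (j k) = 0`. [folklore] -/
theorem degree_succ_le_of_hit {r : ℕ → Fin 4 →₀ ℕ} {j : ℕ → Fin 4} {b : ℕ → Fin 4 → K} {k : ℕ}
    (hlaw : r (k + 1) = ((r k).filter (fun i => b k i = 0)).update (j k) ((r k).degree - 2))
    (hbj : b k (j k) = 0) {N : Fin 4} (hN : j k = N ∨ b k N ≠ 0) :
    (r (k + 1)).degree + r k N ≤ ((r k).degree - 2) + (r k).degree := by
  set f : Fin 4 →₀ ℕ := (r k).filter (fun i => b k i = 0) with hf
  set g : Fin 4 →₀ ℕ := (r k).filter (fun i => ¬ b k i = 0) with hg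
  -- `|r_{k+1}| + f (j k) = |f| + (|r_k| − 2)` and `|f| + |g| = |r_k|`, `f (j k) = r_k (j k)`
  have h1 : (r (k + 1)).degree + f (j k) = f.degree + ((r k).degree - 2) := by
    have e1 : r (k + 1) = f.erase (j k) + Finsupp.single (j k) ((r k).degree - 2) := by
      rw [hlaw, Finsupp.update_eq_erase_add_single]
    have e2 : f = f.erase (j k) + Finsupp.single (j k) (f (j k)) := (Finsupp.erase_add_single (j k) f).symm
    have d1 := congrArg Finsupp.degree e1
    have d2 := congrArg Finsupp.degree e2
    rw [map_add, Finsupp.degree_single] at d1 d2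
    omega
  have h2 : f.degree + g.degree = (r k).degree := by
    rw [← map_add, hf, hg, Finsupp.filter_add_filter_not]
  have h3 : f (j k) = r k (j k) := by rw [hf, Finsupp.filter_apply, if_pos hbj]
  rcases hN with hjN | hbN
  · rw [← hjN, ← h3]; omega
  · have h4 : r k N ≤ g.degree := by
      have hgN : g N = r k N := by rw [hg, Finsupp.filter_apply, if_pos hbN]
      rw [← hgN, Finsupp.degree_eq_sum]
      exact Finset.single_le_sum (fun i _ => Nat.zero_le (g i)) (Finset.mem_univ N)
    omega

/-- The newest letter's weight: `r_{k+1} (j k) = |r_k| − 2`. [folklore] -/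
theorem law_apply_self {r : ℕ → Fin 4 →₀ ℕ} {j : ℕ → Fin 4} {b : ℕ → Fin 4 → K} {k : ℕ}
    (hlaw : r (k + 1) = ((r k).filter (fun i => b k i = 0)).update (j k) ((r k).degree - 2)) :
    r (k + 1) (j k) = (r k).degree - 2 := by
  rw [law_apply hlaw, if_pos rfl]

/-- A kept letter keeps its weight. [folklore] -/
theorem law_apply_kept {r : ℕ → Fin 4 →₀ ℕ} {j : ℕ → Fin 4} {b : ℕ → Fin 4 → K} {k : ℕ}
    (hlaw : r (k + 1) = ((r k).filter (fun i => b k i = 0)).update (j k) ((r k).degree - 2)) {i : Fin 4}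
    (hij : j k ≠ i) (hb : b k i = 0) : r (k + 1) i = r k i := by
  rw [law_apply hlaw, if_neg (Ne.symm hij), if_pos hb]

/-- Three distinct letters weigh at most the degree. [folklore] -/
theorem apply_add_apply_add_apply_le_degree (f : Fin 4 →₀ ℕ) {a b c : Fin 4} (hab : a ≠ b) (hac : a ≠ c)
    (hbc : b ≠ c) : f a + f b + f c ≤ f.degree := by
  classical
  rw [Finsupp.degree_eq_sum]
  have h := Finset.sum_le_sum_of_subset (f := fun i => f i) (Finset.subset_univ ({a, b, c} : Finset (Fin 4)))
  rwa [Finset.sum_insert (by simp [hab, hac]), Finset.sum_pair hbc, ← add_assoc] at h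

/-- **LEMMA H (res-dim4-idea-4): a heavy newest letter is fatal — `|r_k| ≥ 4 ⇒ |r_{k+1}| ≥ 4`.**  If
`|r_k| ≥ 4` then the newest letter `N = j k` weighs `|r_k| − 2 ≥ 2` at `k+1`; keeping it at step `k+1` would be
a satellite step, against the light bound (`|r_k| + |r_{k+1}| ≤ 6`); hitting it leaves `|r_{k+2}| ≤ 2`,
below the floor — unless `|r_{k+1}| ≥ 4` as well. [OURS] [folklore] -/
theorem four_le_degree_succ {r : ℕ → Fin 4 →₀ ℕ} {j : ℕ → Fin 4} {b : ℕ → Fin 4 → K} {k₀ : ℕ}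
    (hlaw : ∀ k, k₀ ≤ k → r (k + 1) = ((r k).filter (fun i => b k i = 0)).update (j k) ((r k).degree - 2))
    (hbj : ∀ k, b k (j k) = 0) (hfloor : ∀ k, k₀ ≤ k → 3 ≤ (r k).degree)
    (hlight : ∀ k, k₀ ≤ k → FreeTail.IsSatellite j b k → (r k).degree + (r (k + 1)).degree ≤ 6)
    {k : ℕ} (hk : k₀ ≤ k) (h4 : 4 ≤ (r k).degree) : 4 ≤ (r (k + 1)).degree := by
  by_contra hlt
  -- step `k+1` is not a satellite: it hits `j k`
  have hnsat : ¬ FreeTail.IsSatellite j b k := fun hsat => by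
    have := hlight k hk hsat; have := hfloor (k + 1) (by omega); omega
  have hhit : j (k + 1) = j k ∨ b (k + 1) (j k) ≠ 0 := by
    by_contra h
    push Not at h
    exact hnsat ⟨h.1, h.2⟩
  have h1 := degree_succ_le_of_hit (hlaw (k + 1) (by omega)) (hbj (k + 1)) hhit
  rw [law_apply_self (hlaw k hk)] at h1
  have h2 := hfloor (k + 1 + 1) (by omega)
  have h3 := hfloor (k + 1) (by omega)
  omega

/-- **COROLLARY `|r| ≡ 3` (`o ≡ 6`)**: an upper run `|r_k| ≥ 4` for ever being excluded, `|r_k| = 3` for all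
`k ≥ k₀`. [OURS] [folklore] -/
theorem degree_eq_three {r : ℕ → Fin 4 →₀ ℕ} {j : ℕ → Fin 4} {b : ℕ → Fin 4 → K} {k₀ : ℕ}
    (hlaw : ∀ k, k₀ ≤ k → r (k + 1) = ((r k).filter (fun i => b k i = 0)).update (j k) ((r k).degree - 2))
    (hbj : ∀ k, b k (j k) = 0) (hfloor : ∀ k, k₀ ≤ k → 3 ≤ (r k).degree)
    (hlight : ∀ k, k₀ ≤ k → FreeTail.IsSatellite j b k → (r k).degree + (r (k + 1)).degree ≤ 6)
    (hupper : ∀ k₁, k₀ ≤ k₁ → ∃ k, k₁ ≤ k ∧ (r k).degree ≤ 3) {k : ℕ} (hk : k₀ ≤ k) : (r k).degree = 3 := by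
  refine le_antisymm ?_ (hfloor k hk)
  by_contra h4
  have hrun : ∀ n, 4 ≤ (r (k + n)).degree := by
    intro n
    induction n with
    | zero => simpa using (by omega : 4 ≤ (r k).degree)
    | succ n ih =>
      have h := four_le_degree_succ hlaw hbj hfloor hlight (k := k + n) (by omega) ih
      simpa only [Nat.add_succ] using h
  obtain ⟨k', hk', hle⟩ := hupper k hk
  obtain ⟨n, rfl⟩ := Nat.exists_eq_add_of_le hk'
  have := hrun n
  omega

/-- **WEIGHT NORMALISATION** (res-dim4-p-12 (ii)): with `|r| ≡ 3`, a letter `W` of weight `≥ 2` at some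
`k ≥ k₀` is kept for ever (hitting it would leave `|r| ≤ 2`) and then every step hits the newest letter: no
satellite step from `k` on. [OURS] [folklore] -/
theorem not_isSatellite_of_heavy {r : ℕ → Fin 4 →₀ ℕ} {j : ℕ → Fin 4} {b : ℕ → Fin 4 → K} {k₀ : ℕ}
    (hlaw : ∀ k, k₀ ≤ k → r (k + 1) = ((r k).filter (fun i => b k i = 0)).update (j k) ((r k).degree - 2))
    (hbj : ∀ k, b k (j k) = 0) (h3 : ∀ k, k₀ ≤ k → (r k).degree = 3) {k : ℕ} (hk : k₀ ≤ k) {W : Fin 4}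
    (hW : 2 ≤ r k W) : ∀ k', k ≤ k' → ¬ FreeTail.IsSatellite j b k' := by
  -- `W` is kept for ever, with weight `≥ 2`
  have hkept : ∀ n, 2 ≤ r (k + n) W ∧ j (k + n) ≠ W ∧ b (k + n) W = 0 := by
    intro n
    induction n with
    | zero =>
      have hWk : 2 ≤ r (k + 0) W := by simpa using hW
      refine ⟨hWk, ?_, ?_⟩ <;> by_contra hh
      · have h := degree_succ_le_of_hit (hlaw (k + 0) (by omega)) (hbj _) (N := W) (Or.inl hh)
        have := h3 (k + 0) (by omega); have := h3 (k + 0 + 1) (by omega); omega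
      · have h := degree_succ_le_of_hit (hlaw (k + 0) (by omega)) (hbj _) (N := W) (Or.inr hh)
        have := h3 (k + 0) (by omega); have := h3 (k + 0 + 1) (by omega); omega
    | succ n ih =>
      obtain ⟨h2, hj, hb⟩ := ih
      have hW' : 2 ≤ r (k + (n + 1)) W := by
        rw [show k + (n + 1) = k + n + 1 by ring, law_apply_kept (hlaw (k + n) (by omega)) hj hb]; exact h2
      refine ⟨hW', ?_, ?_⟩ <;> by_contra hh
      · have h := degree_succ_le_of_hit (hlaw (k + (n + 1)) (by omega)) (hbj _) (N := W) (Or.inl hh)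
        have := h3 (k + (n + 1)) (by omega); have := h3 (k + (n + 1) + 1) (by omega); omega
      · have h := degree_succ_le_of_hit (hlaw (k + (n + 1)) (by omega)) (hbj _) (N := W) (Or.inr hh)
        have := h3 (k + (n + 1)) (by omega); have := h3 (k + (n + 1) + 1) (by omega); omega
  -- hence the newest letter is hit at every later step
  intro k' hk' hsat
  obtain ⟨n, rfl⟩ := Nat.exists_eq_add_of_le hk'
  obtain ⟨hW1, hjW1, hbW1⟩ := hkept (n + 1)
  obtain ⟨-, hjW, -⟩ := hkept n
  -- at `k+n+2`: the new letter `j (k+n+1)` (weight 1), `W` (weight ≥ 2) and the kept `j (k+n)` (weight 1)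
  have hlaw1 := hlaw (k + n + 1) (by omega)
  have hnew : r (k + n + 1 + 1) (j (k + n + 1)) = 1 := by
    rw [law_apply_self hlaw1, h3 (k + n + 1) (by omega)]
  have hWn : 2 ≤ r (k + n + 1 + 1) W := by
    rw [law_apply_kept hlaw1 (by simpa [add_assoc] using hjW1) (by simpa [add_assoc] using hbW1)]
    simpa [add_assoc] using hW1
  have hold : r (k + n + 1 + 1) (j (k + n)) = 1 := by
    rw [law_apply_kept hlaw1 hsat.1 hsat.2, law_apply_self (hlaw (k + n) (by omega)), h3 (k + n) (by omega)]
  have hdeg := apply_add_apply_add_apply_le_degree (r (k + n + 1 + 1)) (a := j (k + n + 1)) (b := W)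
    (c := j (k + n)) (by simpa [add_assoc] using hjW1) hsat.1 (Ne.symm hjW)
  have := h3 (k + n + 1 + 1) (by omega)
  omega

/-- **THE LIGHT-TAIL WEIGHTS, core form**: no upper run ⇒ either a free tail (`¬ IsSatellite` from some index
on) or, from `k₀` on, `|r_k| = 3` with every weight `≤ 1` (three alive letters of weight one). [OURS] [folklore] -/
theorem light_weights_core {r : ℕ → Fin 4 →₀ ℕ} {j : ℕ → Fin 4} {b : ℕ → Fin 4 → K} {k₀ : ℕ}
    (hlaw : ∀ k, k₀ ≤ k → r (k + 1) = ((r k).filter (fun i => b k i = 0)).update (j k) ((r k).degree - 2))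
    (hbj : ∀ k, b k (j k) = 0) (hfloor : ∀ k, k₀ ≤ k → 3 ≤ (r k).degree)
    (hlight : ∀ k, k₀ ≤ k → FreeTail.IsSatellite j b k → (r k).degree + (r (k + 1)).degree ≤ 6)
    (hupper : ∀ k₁, k₀ ≤ k₁ → ∃ k, k₁ ≤ k ∧ (r k).degree ≤ 3) :
    (∃ k₁, k₀ ≤ k₁ ∧ ∀ k, k₁ ≤ k → ¬ FreeTail.IsSatellite j b k) ∨
    (∀ k, k₀ ≤ k → (∀ i, r k i ≤ 1) ∧ (r k).degree = 3) := by
  have h3 : ∀ k, k₀ ≤ k → (r k).degree = 3 := fun k hk => degree_eq_three hlaw hbj hfloor hlight hupper hk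
  by_cases hheavy : ∃ k, k₀ ≤ k ∧ ∃ W, 2 ≤ r k W
  · obtain ⟨k, hk, W, hW⟩ := hheavy
    exact Or.inl ⟨k, hk, not_isSatellite_of_heavy hlaw hbj h3 hk hW⟩
  · push Not at hheavy
    exact Or.inr fun k hk => ⟨fun i => by have := hheavy k hk i; omega, h3 k hk⟩

end Core

/-! ## 2. The dress: witnessed isolated above-floor `Step0 5` chains of constant shade `3` -/

section Chain

variable [CharP K 5] [DecidableEq K]

/-- **THE LIGHT-TAIL WEIGHTS** (brick K26a; `p = 5`, `d = 3`): along a witnessed isolated above-floor `Step0 5`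
chain of constant shade `3` from `k₀`, GIVEN the light bound `o_k + o_{k+1} + 3 ≤ 15` at every satellite step
`k ≥ k₀` (K12b, from the stretch-born ledgers of the assembly), either (T1) the chain has a free tail, or from `k₀`
on every boundary weight is `≤ 1` and `|r_k| = 3` (`hwt`; in particular `o_k = 6` and every created letter has
weight `1`). [OURS] [folklore] -/
theorem light_weights {c : ℕ → State K} {j : ℕ → Fin 4} {b : ℕ → Fin 4 → K}
    (hc : ∀ k, IsIsolated 5 (c k).F ∧ Step0 5 (c k) (c (k + 1))) (hw : FreeTail.IsWitnessedChain 5 c j b)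
    (hfloor : ∀ k, ordZero (c k).F ≠ 5) {k₀ : ℕ} (hshade : ∀ k, k₀ ≤ k → (c k).shade = ((3 : ℕ) : ℕ∞))
    (hlight : ∀ k, k₀ ≤ k → FreeTail.IsSatellite j b k → ∀ oₖ oₖ₁ : ℕ,
      ordZero (c k).F = oₖ → ordZero (c (k + 1)).F = oₖ₁ → oₖ + oₖ₁ + 3 ≤ 15) :
    (∃ k₁, k₀ ≤ k₁ ∧ ∀ k, k₁ ≤ k → ¬ FreeTail.IsSatellite j b k) ∨
    (∀ k, k₀ ≤ k → (∀ i, (c k).r i ≤ 1) ∧ (c k).r.degree = 3) := by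
  haveI : Fact (Nat.Prime 5) := ⟨by norm_num⟩
  -- `o_k = |r_k| + 3` on the tail
  have hord : ∀ k, k₀ ≤ k → ordZero (c k).F = (((c k).r.degree + 3 : ℕ) : ℕ∞) := by
    intro k hk
    obtain ⟨o, ho, hpo, -, hd⟩ := chain_shade_nat 5 hc hfloor hshade hk
    rw [ho]; congr 1; omega
  have hlaw : ∀ k, k₀ ≤ k →
      (c (k + 1)).r = ((c k).r.filter (fun i => b k i = 0)).update (j k) ((c k).r.degree - 2) := by
    intro k hk
    rw [(hw k).2.2.2.2, step_r_univ' 5 (j k) (b k) (c k) (hord k hk)]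
    congr 1
  have hbj : ∀ k, b k (j k) = 0 := fun k => (hw k).2.1
  have hfloor' : ∀ k, k₀ ≤ k → 3 ≤ (c k).r.degree := by
    intro k hk
    obtain ⟨o, ho, hpo, -, hd⟩ := chain_shade_nat 5 hc hfloor hshade hk
    omega
  have hlight' : ∀ k, k₀ ≤ k → FreeTail.IsSatellite j b k → (c k).r.degree + (c (k + 1)).r.degree ≤ 6 := by
    intro k hk hsat
    have h := hlight k hk hsat _ _ (hord k hk) (hord (k + 1) (by omega))
    omega
  have hupper : ∀ k₁, k₀ ≤ k₁ → ∃ k, k₁ ≤ k ∧ (c k).r.degree ≤ 3 := by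
    intro k₁ hk₁
    by_contra hno
    push Not at hno
    refine BandLayers.no_isolated_chain_eventually_upper 5 hc (k₀ := k₁) fun k hk => ?_
    rw [hord k (le_trans hk₁ hk)]
    have := hno k hk
    exact_mod_cast (by norm_num; omega)
  exact light_weights_core hlaw hbj hfloor' hlight' hupper

/-- **The light-tail trichotomy at `p = 5` with `hwt` discharged**: under the hypotheses of `light_weights`, one of
(T1) free tail, (T2) one idle letter + two born, (T3) three born (`light_tail_trichotomy` on `hB3` from
`light_weights`). [OURS] [folklore] -/
theorem light_tail_trichotomy_five {c : ℕ → State K} {j : ℕ → Fin 4} {b : ℕ → Fin 4 → K}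
    (hc : ∀ k, IsIsolated 5 (c k).F ∧ Step0 5 (c k) (c (k + 1))) (hw : FreeTail.IsWitnessedChain 5 c j b)
    (hfloor : ∀ k, ordZero (c k).F ≠ 5) {k₀ : ℕ} (hshade : ∀ k, k₀ ≤ k → (c k).shade = ((3 : ℕ) : ℕ∞))
    (hlight : ∀ k, k₀ ≤ k → FreeTail.IsSatellite j b k → ∀ oₖ oₖ₁ : ℕ,
      ordZero (c k).F = oₖ → ordZero (c (k + 1)).F = oₖ₁ → oₖ + oₖ₁ + 3 ≤ 15) :
    (∃ k₁, k₀ ≤ k₁ ∧ ∀ k, k₁ ≤ k → ¬ FreeTail.IsSatellite j b k) ∨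
    (∃ ν : Fin 4, ∃ k₁, k₀ ≤ k₁ ∧ (∀ k, k₁ ≤ k → 1 ≤ (c k).r ν ∧ j k ≠ ν ∧ b k ν = 0) ∧
      (∀ k, k₁ ≤ k → ∀ i, i ≠ ν → 1 ≤ (c k).r i →
        ∃ t, k₀ ≤ t ∧ t < k ∧ j t = i ∧ ∀ m, t < m → m < k → j m ≠ i ∧ b m i = 0)) ∨
    (∃ k₁, k₀ ≤ k₁ ∧ ∀ k, k₁ ≤ k → ∀ i, 1 ≤ (c k).r i →
        ∃ t, k₀ ≤ t ∧ t < k ∧ j t = i ∧ ∀ m, t < m → m < k → j m ≠ i ∧ b m i = 0) := by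
  haveI : Fact (Nat.Prime 5) := ⟨by norm_num⟩
  rcases light_weights hc hw hfloor hshade hlight with h | h
  · exact Or.inl h
  · refine light_tail_trichotomy 5 hc hw hfloor (k₀ := k₀) fun k hk => ?_
    obtain ⟨h1, hdeg⟩ := h k hk
    -- weights `≤ 1` and degree `3` give exactly three alive letters
    have hsum : (c k).r.degree = ∑ i, (c k).r i := Finsupp.degree_eq_sum _
    have hcard : (c k).r.support = Finset.univ.filter (fun i => (c k).r i = 1) := by
      ext i
      rw [Finsupp.mem_support_iff, Finset.mem_filter]
      have := h1 i
      constructor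
      · intro h; exact ⟨Finset.mem_univ i, by omega⟩
      · intro h; omega
    rw [hcard]
    have key : ∑ i, (c k).r i = (Finset.univ.filter (fun i => (c k).r i = 1)).card := by
      rw [Finset.card_eq_sum_ones, Finset.sum_filter]
      exact Finset.sum_congr rfl fun i _ => by have := h1 i; split_ifs with h <;> omega
    omega

end Chain

end ResCone

end Summit.ResolutionOfSingularities.ResolutionOfSingularities.Theorems.PIDim4
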